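import Mathlib
import HarnessLib
import Summits.Ventures.LatticeQCDFlow.Exactness.SphereLuscherTrivialization
import Summits.Ventures.LatticeQCDFlow.Exactness.SphereLOMapSecondOrder

/-!
# The order-`K` Lüscher map is trivializing to order `K + 1`, quantitatively: `|⟨H⟩_{e^{−cS}π̄/Z_c} − ∫H∘Φ_{0→c} dπ̄| ≤ c^{K+2}/(K+2)·sup|H|·osc(Σ⟨∂̃S, ∂̃S̃⁽ᴷ⁾⟩)`

HONEST FRAMING: exact (Metropolis-corrected) sampling algorithms for lattice gauge theory;
figures of merit are autocorrelation/cost numbers at stated couplings and volumes; no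
continuum-physics claim.

Venture `LatticeQCDFlow` (cell pub-lqcd), topic `Exactness`; FANOUT row 7 (`s0-cpn-null`: the
S0-D1 rung — 2D CP⁹, Lüscher's trivializing map inside HMC, Engel–Schaefer 2011).  NEW WORK of the
cell over the tree's `Exactness/SphereLuscherTrivialization.lean` (this leg: the covariance law
`(d/ds)⟨H∘Φ_{s→c}⟩_s = s^{K+1}·Cov_s(H∘Φ_{s→c}, V_K)` for the flow of the truncated series) and
`Exactness/SphereLOMapSecondOrder.lean` (this leg: `|Cov_s(K, V)| ≤ M_K·M_V` for `0 ≤ V ≤ M_V`) and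
Mathlib (`antitoneOn_of_hasDerivWithinAt_nonpos`, `monotoneOn_of_hasDerivWithinAt_nonneg`); nothing
is cited as a fact.  Printed counterpart, NAMED ONLY: M. Lüscher, Commun. Math. Phys. 293 (2010)
899, §4.3 (the truncated trivializing maps and the residual they leave to the HMC).

* §1 **`|Cov_s(K, V)| ≤ M_K·(M_V − m_V)` for `m_V ≤ V ≤ M_V`** (**`abs_tiltedCov_le_osc`**: shift `V`
  by `m_V`; the covariance is shift invariant).
* §2 **THE ORDER-`K` DEFECT BOUND** (**`abs_tiltedMean_sub_integral_comp_sphereTDFlow_partialSum_le`**):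
  for a `C¹` action `S`, a `C²` Lüscher series `(S̃⁽ᵏ⁾, ċ_k)` of `S`, `0 ≤ c`, the evolution map
  `Φ_{0→c}` of Lüscher's flow generated by `Σ_{k≤K}t^kS̃⁽ᵏ⁾` (horizon `c`), every `C¹` observable
  with `|H| ≤ M_H` on `Ω` and every pair of bounds `m_V ≤ V_K ≤ M_V` on `Ω`
  (`V_K = Σ_n⟨∂̃_nS, ∂̃_nS̃⁽ᴷ⁾⟩`):
  `|∫e^{−cS}H dπ̄/∫e^{−cS}dπ̄ − ∫H(Φ_{0→c}ω)dπ̄(ω)| ≤ c^{K+2}/(K+2)·M_H·(M_V − m_V)`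
  — `g(s) = ⟨H∘Φ_{s→c}⟩_s` has `|g′(s)| ≤ s^{K+1}M_H(M_V − m_V)` on `[0, c]`, so
  `g ∓ M_H(M_V − m_V)s^{K+2}/(K+2)` are monotone; `g(c) = ⟨H⟩_c`, `g(0) = ∫H∘Φ_{0→c}dπ̄`.
  THE BIAS OF THE UNCORRECTED ORDER-`K` MAP IS `O(c^{K+2})` WITH AN EXPLICIT CONSTANT, the
  oscillation of the single cross term `V_K` that the truncation leaves in Lüscher's equation.

NOT CLAIMED: bounds on `osc(V_K)` in terms of the couplings for `K ≥ 1` (for `K = 0` and the E–S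
action `V₀ = (2κ²/(d−1))Σ‖p_n‖² ≤ (2κ²/(d−1))Σ_n(Σ_m‖U_nm‖)²`, `Exactness/SphereLOMapTransportDefect`);
the variance of the residual action / acceptance rates; convergence as `K → ∞`; anything about
autocorrelations or the rung's numbers.
-/

noncomputable section

namespace Summit.Ventures.LatticeQCDFlow.Exactness

open Function Set Metric MeasureTheory NormedSpace InnerProductSpace
open scoped RealInnerProductSpace Topology

variable {Λ : Type*} {E : Type*} [NormedAddCommGroup E] [InnerProductSpace ℝ E]
  [FiniteDimensional ℝ E] [Fintype Λ] [MeasurableSpace E] [BorelSpace E] [Nontrivial E]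

/-! ## §1 The covariance bound with an oscillation -/

section Cov

/-- **`|Cov_s(K, V)| ≤ M_K·(M_V − m_V)`**: a tilted covariance `∫wKV/∫w − (∫wK/∫w)(∫wV/∫w)`,
`w = e^{−sS}`, of continuous `K`, `V` on `Ω` with `|K| ≤ M_K` and `m_V ≤ V ≤ M_V` is at most
`M_K·(M_V − m_V)` in absolute value. -/
theorem abs_tiltedCov_le_osc {S : (Λ → E) → ℝ} (hS : Continuous S) (s : ℝ)
    {K V : (Λ → sphere (0 : E) 1) → ℝ} (hK : Continuous K) (hV : Continuous V) {MK mV MV : ℝ}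
    (hKb : ∀ ω, |K ω| ≤ MK) (hVm : ∀ ω, mV ≤ V ω) (hVb : ∀ ω, V ω ≤ MV) :
    |(∫ ω, Real.exp (-(s * S (fun m => ((ω : Λ → sphere (0 : E) 1) m : E)))) * K ω * V ω
          ∂Measure.pi (fun _ : Λ => uniformSphere (volume : Measure E))) /
          (∫ ω, Real.exp (-(s * S (fun m => ((ω : Λ → sphere (0 : E) 1) m : E))))
            ∂Measure.pi (fun _ : Λ => uniformSphere (volume : Measure E))) -
        (∫ ω, Real.exp (-(s * S (fun m => ((ω : Λ → sphere (0 : E) 1) m : E)))) * K ω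
            ∂Measure.pi (fun _ : Λ => uniformSphere (volume : Measure E))) /
            (∫ ω, Real.exp (-(s * S (fun m => ((ω : Λ → sphere (0 : E) 1) m : E))))
              ∂Measure.pi (fun _ : Λ => uniformSphere (volume : Measure E))) *
          ((∫ ω, Real.exp (-(s * S (fun m => ((ω : Λ → sphere (0 : E) 1) m : E)))) * V ω
              ∂Measure.pi (fun _ : Λ => uniformSphere (volume : Measure E))) /
            ∫ ω, Real.exp (-(s * S (fun m => ((ω : Λ → sphere (0 : E) 1) m : E))))
              ∂Measure.pi (fun _ : Λ => uniformSphere (volume : Measure E)))| ≤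
      MK * (MV - mV) := by
  classical
  have h := abs_tiltedCov_le (Λ := Λ) hS s hK (hV.sub continuous_const) (V := fun ω => V ω - mV)
    (MV := MV - mV) hKb (fun ω => sub_nonneg.2 (hVm ω)) (fun ω => sub_le_sub_right (hVb ω) _)
  have hZ := integral_exp_neg_mul_pos (Λ := Λ) (E := E) hS s
  have hw : Continuous fun ω : Λ → sphere (0 : E) 1 => Real.exp (-(s * S (fun m => (ω m : E)))) :=
    continuous_exp_neg_mul_sphereConfig hS s
  have hiKV : Integrable (fun ω : Λ → sphere (0 : E) 1 =>
      Real.exp (-(s * S (fun m => (ω m : E)))) * K ω * V ω)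
      (Measure.pi fun _ : Λ => uniformSphere (volume : Measure E)) :=
    integrable_pi_of_continuous _ ((hw.mul hK).mul hV)
  have hiK : Integrable (fun ω : Λ → sphere (0 : E) 1 => Real.exp (-(s * S (fun m => (ω m : E)))) * K ω)
      (Measure.pi fun _ : Λ => uniformSphere (volume : Measure E)) :=
    integrable_pi_of_continuous _ (hw.mul hK)
  have hiV : Integrable (fun ω : Λ → sphere (0 : E) 1 => Real.exp (-(s * S (fun m => (ω m : E)))) * V ω)
      (Measure.pi fun _ : Λ => uniformSphere (volume : Measure E)) :=
    integrable_pi_of_continuous _ (hw.mul hV)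
  have hiw : Integrable (fun ω : Λ → sphere (0 : E) 1 => Real.exp (-(s * S (fun m => (ω m : E)))))
      (Measure.pi fun _ : Λ => uniformSphere (volume : Measure E)) := integrable_pi_of_continuous _ hw
  -- shift invariance of the covariance
  have e1 : ∫ ω, Real.exp (-(s * S (fun m => ((ω : Λ → sphere (0 : E) 1) m : E)))) * K ω * (V ω - mV)
      ∂Measure.pi (fun _ : Λ => uniformSphere (volume : Measure E)) =
      (∫ ω, Real.exp (-(s * S (fun m => ((ω : Λ → sphere (0 : E) 1) m : E)))) * K ω * V ω
        ∂Measure.pi (fun _ : Λ => uniformSphere (volume : Measure E))) -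
        mV * ∫ ω, Real.exp (-(s * S (fun m => ((ω : Λ → sphere (0 : E) 1) m : E)))) * K ω
          ∂Measure.pi (fun _ : Λ => uniformSphere (volume : Measure E)) := by
    rw [← integral_const_mul, ← integral_sub hiKV (hiK.const_mul mV)]
    refine integral_congr_ae (ae_of_all _ fun ω => ?_)
    ring
  have e2 : ∫ ω, Real.exp (-(s * S (fun m => ((ω : Λ → sphere (0 : E) 1) m : E)))) * (V ω - mV)
      ∂Measure.pi (fun _ : Λ => uniformSphere (volume : Measure E)) =
      (∫ ω, Real.exp (-(s * S (fun m => ((ω : Λ → sphere (0 : E) 1) m : E)))) * V ω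
        ∂Measure.pi (fun _ : Λ => uniformSphere (volume : Measure E))) -
        mV * ∫ ω, Real.exp (-(s * S (fun m => ((ω : Λ → sphere (0 : E) 1) m : E))))
          ∂Measure.pi (fun _ : Λ => uniformSphere (volume : Measure E)) := by
    rw [← integral_const_mul, ← integral_sub hiV (hiw.const_mul mV)]
    refine integral_congr_ae (ae_of_all _ fun ω => ?_)
    ring
  have key : ∀ A B V Z : ℝ, Z ≠ 0 →
      (B - mV * A) / Z - A / Z * ((V - mV * Z) / Z) = B / Z - A / Z * (V / Z) := by
    intro A B V Z hZ0
    field_simp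
    ring
  simp only [e1, e2, key _ _ _ _ hZ.ne'] at h
  exact h

end Cov

/-! ## §2 The order-`K` defect bound -/

section Defect

variable [DecidableEq Λ] {S : (Λ → E) → ℝ} {St : ℕ → (Λ → E) → ℝ} {c : ℕ → ℝ}

/-- **THE ORDER-`K` LÜSCHER MAP IS TRIVIALIZING TO ORDER `K + 1`, QUANTITATIVELY.**  Let `S ∈ C¹`,
`(S̃⁽ᵏ⁾, ċ_k)` a `C²` Lüscher series of `S`, `0 ≤ cf`, `Φ = sphereTDFlow _ cf` the evolution maps of
Lüscher's flow generated by `G_t = Σ_{k≤K}t^kS̃⁽ᵏ⁾`, `H ∈ C¹` with `|H| ≤ M_H` on `Ω`, and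
`m_V ≤ V_K ≤ M_V` on `Ω`, `V_K = Σ_n⟨∂̃_nS, ∂̃_nS̃⁽ᴷ⁾⟩`.  Then
`|∫e^{−cf·S}H dπ̄/∫e^{−cf·S}dπ̄ − ∫H(Φ_{0→cf}ω)dπ̄(ω)| ≤ cf^{K+2}/(K+2)·M_H·(M_V − m_V)`. -/
theorem abs_tiltedMean_sub_integral_comp_sphereTDFlow_partialSum_le (hS : ContDiff ℝ 1 S)
    (hSt : ∀ k, ContDiff ℝ 2 (St k))
    (h0 : ∀ ξ : Λ → sphere (0 : E) 1,
      -∑ n, siteLaplacian n (St 0) (fun m => (ξ m : E)) = S (fun m => (ξ m : E)) + c 0)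
    (hs : ∀ k, ∀ ξ : Λ → sphere (0 : E) 1,
      -∑ n, siteLaplacian n (St (k + 1)) (fun m => (ξ m : E)) =
        -(∑ n, ⟪siteGrad n S (fun m => (ξ m : E)), siteGrad n (St k) (fun m => (ξ m : E))⟫) +
          c (k + 1))
    (K : ℕ) {H : (Λ → E) → ℝ} (hH : ContDiff ℝ 1 H) {cf : ℝ} (hcf : 0 ≤ cf) {MH mV MV : ℝ}
    (hHb : ∀ ω : Λ → sphere (0 : E) 1, |H (fun m => (ω m : E))| ≤ MH)
    (hVm : ∀ ω : Λ → sphere (0 : E) 1,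
      mV ≤ ∑ n, ⟪siteGrad n S (fun m => (ω m : E)), siteGrad n (St K) (fun m => (ω m : E))⟫)
    (hVb : ∀ ω : Λ → sphere (0 : E) 1,
      ∑ n, ⟪siteGrad n S (fun m => (ω m : E)), siteGrad n (St K) (fun m => (ω m : E))⟫ ≤ MV) :
    |(∫ ω, Real.exp (-(cf * S (fun m => ((ω : Λ → sphere (0 : E) 1) m : E)))) * H (fun m => (ω m : E))
          ∂Measure.pi (fun _ : Λ => uniformSphere (volume : Measure E))) /
          (∫ ω, Real.exp (-(cf * S (fun m => ((ω : Λ → sphere (0 : E) 1) m : E))))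
            ∂Measure.pi (fun _ : Λ => uniformSphere (volume : Measure E))) -
        ∫ ω, H (sphereTDFlow (G := fun t z => ∑ k ∈ Finset.range (K + 1), t ^ k * St k z)
          (contDiff_partialSum_joint hSt K) cf 0 cf (fun m => ((ω : Λ → sphere (0 : E) 1) m : E)))
            ∂Measure.pi (fun _ : Λ => uniformSphere (volume : Measure E))| ≤
      cf ^ (K + 2) / ((K : ℝ) + 2) * MH * (MV - mV) := by
  have hG := contDiff_partialSum_joint (Λ := Λ) hSt K
  -- the tilted mean of the transported observable
  set g : ℝ → ℝ := fun s =>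
    (∫ ω, Real.exp (-(s * S (fun m => ((ω : Λ → sphere (0 : E) 1) m : E)))) *
        H (sphereTDFlow (G := fun t z => ∑ k ∈ Finset.range (K + 1), t ^ k * St k z) hG cf s cf
          (fun m => (ω m : E))) ∂Measure.pi (fun _ : Λ => uniformSphere (volume : Measure E))) /
      ∫ ω, Real.exp (-(s * S (fun m => ((ω : Λ → sphere (0 : E) 1) m : E))))
        ∂Measure.pi (fun _ : Λ => uniformSphere (volume : Measure E)) with hg
  set cov : ℝ → ℝ := fun s =>
    (∫ ω, Real.exp (-(s * S (fun m => ((ω : Λ → sphere (0 : E) 1) m : E)))) *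
        H (sphereTDFlow (G := fun t z => ∑ k ∈ Finset.range (K + 1), t ^ k * St k z) hG cf s cf
          (fun m => (ω m : E))) *
          ∑ n, ⟪siteGrad n S (fun m => (ω m : E)), siteGrad n (St K) (fun m => (ω m : E))⟫
        ∂Measure.pi (fun _ : Λ => uniformSphere (volume : Measure E))) /
        (∫ ω, Real.exp (-(s * S (fun m => ((ω : Λ → sphere (0 : E) 1) m : E))))
          ∂Measure.pi (fun _ : Λ => uniformSphere (volume : Measure E))) -
      (∫ ω, Real.exp (-(s * S (fun m => ((ω : Λ → sphere (0 : E) 1) m : E)))) *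
          H (sphereTDFlow (G := fun t z => ∑ k ∈ Finset.range (K + 1), t ^ k * St k z) hG cf s cf
            (fun m => (ω m : E))) ∂Measure.pi (fun _ : Λ => uniformSphere (volume : Measure E))) /
        (∫ ω, Real.exp (-(s * S (fun m => ((ω : Λ → sphere (0 : E) 1) m : E))))
          ∂Measure.pi (fun _ : Λ => uniformSphere (volume : Measure E))) *
      ((∫ ω, Real.exp (-(s * S (fun m => ((ω : Λ → sphere (0 : E) 1) m : E)))) *
            ∑ n, ⟪siteGrad n S (fun m => (ω m : E)), siteGrad n (St K) (fun m => (ω m : E))⟫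
          ∂Measure.pi (fun _ : Λ => uniformSphere (volume : Measure E))) /
        ∫ ω, Real.exp (-(s * S (fun m => ((ω : Λ → sphere (0 : E) 1) m : E))))
          ∂Measure.pi (fun _ : Λ => uniformSphere (volume : Measure E))) with hcov
  -- its derivative inside the window `[0, cf]`
  have hderiv : ∀ s ∈ Icc 0 cf, HasDerivAt g (s ^ (K + 1) * cov s) s := fun s hsI => by
    have hs' : |s| ≤ |cf| + 1 := by
      rw [abs_of_nonneg hsI.1, abs_of_nonneg hcf]; linarith [hsI.2]
    exact hasDerivAt_tiltedMean_comp_sphereTDFlow_partialSum hS hSt h0 hs K hH cf cf hs'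
  -- `|cov s| ≤ MH · (MV − mV)`
  set M : ℝ := MH * (MV - mV) with hM
  have hcovb : ∀ s, |cov s| ≤ M := fun s => by
    have hcK : Continuous fun ω : Λ → sphere (0 : E) 1 =>
        H (sphereTDFlow (G := fun t z => ∑ k ∈ Finset.range (K + 1), t ^ k * St k z) hG cf s cf
          (fun m => (ω m : E))) :=
      (hH.continuous.comp (contDiff_sphereTDFlow_apply hG s cf).continuous).comp
        continuous_sphereConfig
    have hcV : Continuous fun ω : Λ → sphere (0 : E) 1 =>
        ∑ n, ⟪siteGrad n S (fun m => (ω m : E)), siteGrad n (St K) (fun m => (ω m : E))⟫ :=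
      continuous_finsetSum _ fun n _ => continuous_inner_siteGrad ((hSt K).of_le (by norm_num)) hS n n
    exact abs_tiltedCov_le_osc hS.continuous s hcK hcV
      (fun ω => hHb (fun n => ⟨sphereTDFlow hG cf s cf (fun m => (ω m : E)) n, by
        rw [mem_sphere_zero_iff_norm]
        exact norm_sphereTDFlow_eq_one hG s (fun m => by simp) cf n⟩))
      hVm hVb
  -- the comparison functions
  have hK2 : ((K : ℝ) + 2) ≠ 0 := by positivity
  have hpow : ∀ s : ℝ, HasDerivAt (fun y : ℝ => M / ((K : ℝ) + 2) * y ^ (K + 2)) (M * s ^ (K + 1)) s :=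
    fun s => by
    have h := (hasDerivAt_pow (K + 2) s).const_mul (M / ((K : ℝ) + 2))
    have e : K + 2 - 1 = K + 1 := by omega
    rw [e] at h
    refine h.congr_deriv ?_
    push_cast
    field_simp
  have hφ : AntitoneOn (fun s => g s - M / ((K : ℝ) + 2) * s ^ (K + 2)) (Icc 0 cf) := by
    refine antitoneOn_of_hasDerivWithinAt_nonpos (convex_Icc 0 cf)
      (f' := fun s => s ^ (K + 1) * cov s - M * s ^ (K + 1))
      (fun s hsI => ((hderiv s hsI).sub (hpow s)).continuousAt.continuousWithinAt)
      (fun s hsI => ?_) fun s hsI => ?_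
    · rw [interior_Icc] at hsI
      exact ((hderiv s (Ioo_subset_Icc_self hsI)).sub (hpow s)).hasDerivWithinAt
    · rw [interior_Icc] at hsI
      have hsK : 0 ≤ s ^ (K + 1) := pow_nonneg hsI.1.le _
      have h1 : s ^ (K + 1) * cov s ≤ s ^ (K + 1) * M :=
        mul_le_mul_of_nonneg_left ((le_abs_self _).trans (hcovb s)) hsK
      linarith [h1]
  have hψ : MonotoneOn (fun s => g s + M / ((K : ℝ) + 2) * s ^ (K + 2)) (Icc 0 cf) := by
    refine monotoneOn_of_hasDerivWithinAt_nonneg (convex_Icc 0 cf)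
      (f' := fun s => s ^ (K + 1) * cov s + M * s ^ (K + 1))
      (fun s hsI => ((hderiv s hsI).add (hpow s)).continuousAt.continuousWithinAt)
      (fun s hsI => ?_) fun s hsI => ?_
    · rw [interior_Icc] at hsI
      exact ((hderiv s (Ioo_subset_Icc_self hsI)).add (hpow s)).hasDerivWithinAt
    · rw [interior_Icc] at hsI
      have hsK : 0 ≤ s ^ (K + 1) := pow_nonneg hsI.1.le _
      have h1 : s ^ (K + 1) * -M ≤ s ^ (K + 1) * cov s :=
        mul_le_mul_of_nonneg_left (neg_le.2 ((neg_le_abs _).trans (hcovb s))) hsK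
      linarith [h1]
  have h0c : (0 : ℝ) ∈ Icc 0 cf := ⟨le_rfl, hcf⟩
  have hcc : cf ∈ Icc 0 cf := ⟨hcf, le_rfl⟩
  have hup := hφ h0c hcc hcf
  have hlo := hψ h0c hcc hcf
  have hz : (0 : ℝ) ^ (K + 2) = 0 := zero_pow (by omega)
  simp only [hz, mul_zero, sub_zero, add_zero] at hup hlo
  -- identify `g cf` and `g 0`
  have hgc : g cf = (∫ ω, Real.exp (-(cf * S (fun m => ((ω : Λ → sphere (0 : E) 1) m : E)))) *
        H (fun m => (ω m : E)) ∂Measure.pi (fun _ : Λ => uniformSphere (volume : Measure E))) /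
      ∫ ω, Real.exp (-(cf * S (fun m => ((ω : Λ → sphere (0 : E) 1) m : E))))
        ∂Measure.pi (fun _ : Λ => uniformSphere (volume : Measure E)) := by
    simp only [hg, sphereTDFlow_self]
  have hg0 : g 0 = ∫ ω, H (sphereTDFlow (G := fun t z => ∑ k ∈ Finset.range (K + 1), t ^ k * St k z)
      hG cf 0 cf (fun m => ((ω : Λ → sphere (0 : E) 1) m : E)))
        ∂Measure.pi (fun _ : Λ => uniformSphere (volume : Measure E)) := by
    simp only [hg, zero_mul, neg_zero, Real.exp_zero, one_mul, integral_const, smul_eq_mul, mul_one,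
      probReal_univ, div_one]
  rw [← hgc, ← hg0, abs_le]
  have hrew : cf ^ (K + 2) / ((K : ℝ) + 2) * MH * (MV - mV) = M / ((K : ℝ) + 2) * cf ^ (K + 2) := by
    rw [hM]; ring
  rw [hrew]
  constructor <;> linarith [hup, hlo]

end Defect

end Summit.Ventures.LatticeQCDFlow.Exactness

end
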